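/-
Origin: expansion seat `planner-pub-hodgecm-toy-g2-0`, handover #26 2026-08-18T09:08:16Z (`HOME/pub-hodgecm-toy-g2/lean/ToyG2/GysinClass.lean`, md5 ed1e2795, 80 lines);
landed by the gen-7 packager in gate run 27 as `HodgeCM/Model/ToyG2/GysinClass.lean` (import ^import ToyG2\.→import HodgeCM.Model.ToyG2. ×1).
-/
/-
# HodgeCM.Model.ToyG2.GysinClass — `RadKilled` is exactly the existence of a rational Gysin class

Generation 2 of the `pub-hodgecm-toy` lineage (seat `planner-pub-hodgecm-toy-g2-0`), DESIGN.md §9 (G1), conceptual form.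

For `f : S ⟶ X` the functional `λ_f = tr_S ∘ ⋀⁴ f^*` on `⋀⁴ H¹(X)` kills the left radical of the trace pairing
`⋀⁴ × ⋀^{2(dim X − 2)} → ℚ` **iff** it is of the form `y ↦ tr_X (y ∧ c)` for some RATIONAL class `c` (no Hodge condition):
finite-dimensional duality (`LinearMap.range_dualMap_eq_dualAnnihilator_ker` + reflexivity).  So hypothesis h1 of
`toyUniverse₃_modelAxioms_of'` says precisely "a rational Gysin class `f_*[S]` exists", and `HodgeRiesz` upgrades it to a Hodge
class; `toyUniverse₃_modelAxioms_of''` records the 28/28 reduction in this language.  The remaining generation-3 task (G1′)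
is therefore a CONSTRUCTION: exhibit `c_f` for targets that are products containing a period block.
-/
import Mathlib
import Summits.HodgeConjecture.HodgeCM.Model.ToyG2.RadicalBlock

/-! PORT of `HodgeCM/Model/ToyG2/GysinClass.lean` (HodgeCMPerL run 82) — verbatim mechanical port; provenance in the PORT header line. -/

namespace HodgeCM.ToyG2

open HodgeCM.Toy HodgeCM.Toy.CMPresentation
open Literature.AlgebraicGeometry.Motives
open scoped TensorProduct
open exteriorPower Obj₂

noncomputable section

/-- a **rational Gysin class** for `f : S ⟶ X` (from a surface): a class `c ∈ ⋀^{2(dim X − 2)} H¹(X)` with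
`tr_S (⋀⁴ f^* y) = tr_X (y ∧ c)` for all `y` — the identity of `Fact_gysin_surface` without the Hodge condition on `c` -/
def HasGysinClass (S X : Obj₂) (f : Hom₂ S X) : Prop :=
  ∃ c : ⋀[ℚ]^(2 * (X.dim - 2)) X.L, ∀ y : ⋀[ℚ]^4 X.L,
    trOf S 4 (map 4 f.lin y) = trOf X (4 + 2 * (X.dim - 2)) (wedge ℚ X.L 4 (2 * (X.dim - 2)) y c)

/-- (Ported verbatim from the HodgeCMPerL package; no docstring in the source.) -/
theorem radKilled_of_hasGysinClass {S X : Obj₂} {f : Hom₂ S X} (h : HasGysinClass S X f) :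
    RadKilled S X f := by
  obtain ⟨c, hc⟩ := h
  intro y hy
  rw [hc y]
  exact (mem_leftRad.1 hy) c

/-- the converse: finite-dimensional duality -/
theorem hasGysinClass_of_radKilled {S X : Obj₂} {f : Hom₂ S X} (h : RadKilled S X f) :
    HasGysinClass S X f := by
  haveI : Module.Free ℚ (↥(⋀[ℚ]^(2 * (X.dim - 2)) X.L)) := Module.Free.of_divisionRing ℚ _
  haveI : Module.Finite ℚ (↥(⋀[ℚ]^(2 * (X.dim - 2)) X.L)) := exteriorPower.instFinite
  haveI : Module.IsReflexive ℚ (↥(⋀[ℚ]^(2 * (X.dim - 2)) X.L)) := Module.IsReflexive.of_finite_of_free ℚ _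
  have hmem : (trOf S 4 ∘ₗ map 4 f.lin) ∈
      (LinearMap.ker (trPairing X 4 (2 * (X.dim - 2)))).dualAnnihilator := by
    rw [Submodule.mem_dualAnnihilator]
    intro y hy
    exact h y hy
  rw [← LinearMap.range_dualMap_eq_dualAnnihilator_ker, LinearMap.mem_range] at hmem
  obtain ⟨ψ, hψ⟩ := hmem
  refine ⟨(Module.evalEquiv ℚ _).symm ψ, fun y => ?_⟩
  have hy := LinearMap.congr_fun hψ y
  rw [LinearMap.dualMap_apply, LinearMap.comp_apply] at hy
  rw [← hy, ← trPairing_apply]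
  exact (Module.apply_evalEquiv_symm_apply ℚ _ _ ψ).symm

/-- (Ported verbatim from the HodgeCMPerL package; no docstring in the source.) -/
theorem radKilled_iff_hasGysinClass {S X : Obj₂} {f : Hom₂ S X} :
    RadKilled S X f ↔ HasGysinClass S X f :=
  ⟨hasGysinClass_of_radKilled, radKilled_of_hasGysinClass⟩

/-- the cases settled in generation 2, in this language -/
theorem hasGysinClass_of_isBlockFree {S X : Obj₂} (hX : X.IsBlockFree) (f : Hom₂ S X) :
    HasGysinClass S X f :=
  hasGysinClass_of_radKilled (radKilled_of_isBlockFree hX f)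

/-- (Ported verbatim from the HodgeCMPerL package; no docstring in the source.) -/
theorem hasGysinClass_pbObj_target {S : Obj₂} {p : PLeaf} (hS : S.dim = 2) (f : Hom₂ S (pbObj p)) :
    HasGysinClass S (pbObj p) f :=
  hasGysinClass_of_radKilled (radKilled_pbObj_target hS f)

/-- **28/28 from "rational Gysin classes exist" + Hodge–Riesz.** -/
theorem toyUniverse₃_modelAxioms_of'' (d t : ℚ)
    (h1 : ∀ (S X : Obj₂) (f : Hom₂ S X), S.Good → X.Good → S.dim = 2 → HasGysinClass S X f)
    (h2 : ∀ X : Obj₂, X.Good → HodgeRiesz X) :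
    (toyUniverse₃ d t).ModelAxioms :=
  toyUniverse₃_modelAxioms_of' d t
    (fun S X f hS hX h2S => radKilled_of_hasGysinClass (h1 S X f hS hX h2S)) h2

end

end HodgeCM.ToyG2
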